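import Mathlib
import Summits.Ventures.PercRepro2.K5HyperCoeffsI
import Summits.Ventures.PercRepro2.K5HyperB

/-!
# THE (ii)- AND (i)-SIDE STAR COMPARISONS AT THE COINCIDENCE MARKINGS AS COEFFICIENT INEQUALITIES
(blind cell PercRepro2, typer-1 g12; the bridge of `K5HyperB.lean` — the same shape as `K5HyperCoeffsI.lean`,
with the marking `b` as a parameter)

The Kronecker numbers `posOnB b` / `negOnB b` / `posOnIB b` / `negOnIB b` encode the masked triple counts
`cPosOnB b` / … (`posOnB_eq`, …, by `kron3_mul_mul`), the placement sums go through the generic encodings of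
`K5HyperCoeffsI.lean` (`sumT1_eq`, `sumT1e1_eq`, `sumE3_eq`), the coefficients are below `KB3`, and `le_of_certLE`
reads every comparison off its certificate at every `K₅` profile `k`:

* **`cNegMB_le_cPosMB`** / **`cNegTvTB_le_cPosTvTB`**: `M(H, T, e) ≥ 0` / `TvT-(ii) ≥ 0` at the marking `b` (the
  (ii) count being `cPos − cNeg`); **`cT1B_le`** / **`cT2B_le`**: the base terms `N(H + T(1)) ≥ 0`, `N(H + T(2)) ≥ 0`;
* **`cNegMIB_le_cPosMIB`** / **`cNegTvTIB_le_cPosTvTIB`** / **`cT1IB_le`** / **`cT2IB_le`**: the same for the (i) side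
  (count `cNeg − cPos`).

The instantiations at the certificates of `K5HyperCert*B{3,0}*.lean` are `K5HyperStarsB.lean`.
-/

namespace Summit.Ventures.PercRepro2

namespace K5

section CoeffsB

variable (b : ℕ)

/-- The positive triples of the cleared (ii) at the marking `b` on a pattern. -/
def cPosOnB (S₁ S₂ S₃ : Fin 10 → Bool) (k : Fin 10 → Fin 4) : ℕ :=
  cOn (tABOb b) tQ tPD S₁ S₂ S₃ k + cOn (tQBb b) tPDoU tA S₁ S₂ S₃ k

/-- The negative triples of the cleared (ii) at the marking `b` on a pattern. -/
def cNegOnB (S₁ S₂ S₃ : Fin 10 → Bool) (k : Fin 10 → Fin 4) : ℕ :=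
  cOn (tQBb b) tAO tPD S₁ S₂ S₃ k + cOn (tABb b) tPDoU tQ S₁ S₂ S₃ k

/-- The positive triples of the cleared (i) at the marking `b` on a pattern. -/
def cPosOnIB (S₁ S₂ S₃ : Fin 10 → Bool) (k : Fin 10 → Fin 4) : ℕ :=
  cOn (tABOLb b) tQ tPD S₁ S₂ S₃ k + cOn (tQBLb b) tPDoU tA S₁ S₂ S₃ k

/-- The negative triples of the cleared (i) at the marking `b` on a pattern. -/
def cNegOnIB (S₁ S₂ S₃ : Fin 10 → Bool) (k : Fin 10 → Fin 4) : ℕ :=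
  cOn (tQBLb b) tAO tPD S₁ S₂ S₃ k + cOn (tABLb b) tPDoU tQ S₁ S₂ S₃ k

/-- `posOnB b` encodes `cPosOnB b`. -/
lemma posOnB_eq (S₁ S₂ S₃ : Fin 10 → Bool) :
    posOnB b S₁ S₂ S₃ = ∑ k, cPosOnB b S₁ S₂ S₃ k * KB3 ^ idx4 k := by
  unfold posOnB
  rw [kron3_mul_mul, kron3_mul_mul, sum_add_mulB]
  rfl

/-- `negOnB b` encodes `cNegOnB b`. -/
lemma negOnB_eq (S₁ S₂ S₃ : Fin 10 → Bool) :
    negOnB b S₁ S₂ S₃ = ∑ k, cNegOnB b S₁ S₂ S₃ k * KB3 ^ idx4 k := by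
  unfold negOnB
  rw [kron3_mul_mul, kron3_mul_mul, sum_add_mulB]
  rfl

/-- `posOnIB b` encodes `cPosOnIB b`. -/
lemma posOnIB_eq (S₁ S₂ S₃ : Fin 10 → Bool) :
    posOnIB b S₁ S₂ S₃ = ∑ k, cPosOnIB b S₁ S₂ S₃ k * KB3 ^ idx4 k := by
  unfold posOnIB
  rw [kron3_mul_mul, kron3_mul_mul, sum_add_mulB]
  rfl

/-- `negOnIB b` encodes `cNegOnIB b`. -/
lemma negOnIB_eq (S₁ S₂ S₃ : Fin 10 → Bool) :
    negOnIB b S₁ S₂ S₃ = ∑ k, cNegOnIB b S₁ S₂ S₃ k * KB3 ^ idx4 k := by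
  unfold negOnIB
  rw [kron3_mul_mul, kron3_mul_mul, sum_add_mulB]
  rfl

/-- Two masked counts. -/
lemma cPosOnB_le (S₁ S₂ S₃ : Fin 10 → Bool) (k : Fin 10 → Fin 4) : cPosOnB b S₁ S₂ S₃ k ≤ 2 * 59049 := by
  unfold cPosOnB
  have := cOn_le (tABOb b) tQ tPD S₁ S₂ S₃ k
  have := cOn_le (tQBb b) tPDoU tA S₁ S₂ S₃ k
  omega

/-- Two masked counts. -/
lemma cNegOnB_le (S₁ S₂ S₃ : Fin 10 → Bool) (k : Fin 10 → Fin 4) : cNegOnB b S₁ S₂ S₃ k ≤ 2 * 59049 := by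
  unfold cNegOnB
  have := cOn_le (tQBb b) tAO tPD S₁ S₂ S₃ k
  have := cOn_le (tABb b) tPDoU tQ S₁ S₂ S₃ k
  omega

/-- Two masked counts. -/
lemma cPosOnIB_le (S₁ S₂ S₃ : Fin 10 → Bool) (k : Fin 10 → Fin 4) : cPosOnIB b S₁ S₂ S₃ k ≤ 2 * 59049 := by
  unfold cPosOnIB
  have := cOn_le (tABOLb b) tQ tPD S₁ S₂ S₃ k
  have := cOn_le (tQBLb b) tPDoU tA S₁ S₂ S₃ k
  omega

/-- Two masked counts. -/
lemma cNegOnIB_le (S₁ S₂ S₃ : Fin 10 → Bool) (k : Fin 10 → Fin 4) : cNegOnIB b S₁ S₂ S₃ k ≤ 2 * 59049 := by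
  unfold cNegOnIB
  have := cOn_le (tQBLb b) tAO tPD S₁ S₂ S₃ k
  have := cOn_le (tABLb b) tPDoU tQ S₁ S₂ S₃ k
  omega

/-! ## The comparisons, (ii) side (count `cPos − cNeg`) -/

/-- The positive side of `M(H, T, e)` at the marking `b`: `N(H+T(1)+e(1))⁺ + N(H+T(1))⁻`. -/
def cPosMB (D P : Fin 10 → Bool) (k : Fin 10 → Fin 4) : ℕ :=
  csumT1e1 (cPosOnB b) D P k + csumT1 (cNegOnB b) D k

/-- The negative side of `M(H, T, e)` at the marking `b`. -/
def cNegMB (D P : Fin 10 → Bool) (k : Fin 10 → Fin 4) : ℕ :=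
  csumT1e1 (cNegOnB b) D P k + csumT1 (cPosOnB b) D k

/-- The positive side of `TvT-(ii)` at the marking `b`: `N(H+△(1,1,1))⁺ + N(H+T(1))⁻`. -/
def cPosTvTB (x y z : ℕ) (k : Fin 10 → Fin 4) : ℕ :=
  csumE3 (cPosOnB b) (pairMask x y) (pairMask x z) (pairMask y z) k + csumT1 (cNegOnB b) (triMask x y z) k

/-- The negative side of `TvT-(ii)` at the marking `b`. -/
def cNegTvTB (x y z : ℕ) (k : Fin 10 → Fin 4) : ℕ :=
  csumE3 (cNegOnB b) (pairMask x y) (pairMask x z) (pairMask y z) k + csumT1 (cPosOnB b) (triMask x y z) k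

/-- `kPosMB b` encodes `cPosMB b`. -/
lemma kPosMB_eq (D P : Fin 10 → Bool) : kPosMB b D P = ∑ k, cPosMB b D P k * KB3 ^ idx4 k := by
  unfold kPosMB
  rw [sumT1e1_eq (cPosOnB b) (posOnB b) (posOnB_eq b), sumT1_eq (cNegOnB b) (negOnB b) (negOnB_eq b), sum_add_mulB]
  rfl

/-- `kNegMB b` encodes `cNegMB b`. -/
lemma kNegMB_eq (D P : Fin 10 → Bool) : kNegMB b D P = ∑ k, cNegMB b D P k * KB3 ^ idx4 k := by
  unfold kNegMB
  rw [sumT1e1_eq (cNegOnB b) (negOnB b) (negOnB_eq b), sumT1_eq (cPosOnB b) (posOnB b) (posOnB_eq b), sum_add_mulB]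
  rfl

/-- `kPosTvTB b` encodes `cPosTvTB b`. -/
lemma kPosTvTB_eq (x y z : ℕ) : kPosTvTB b x y z = ∑ k, cPosTvTB b x y z k * KB3 ^ idx4 k := by
  unfold kPosTvTB
  rw [sumE3_eq (cPosOnB b) (posOnB b) (posOnB_eq b), sumT1_eq (cNegOnB b) (negOnB b) (negOnB_eq b), sum_add_mulB]
  rfl

/-- `kNegTvTB b` encodes `cNegTvTB b`. -/
lemma kNegTvTB_eq (x y z : ℕ) : kNegTvTB b x y z = ∑ k, cNegTvTB b x y z k * KB3 ^ idx4 k := by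
  unfold kNegTvTB
  rw [sumE3_eq (cNegOnB b) (negOnB b) (negOnB_eq b), sumT1_eq (cPosOnB b) (posOnB b) (posOnB_eq b), sum_add_mulB]
  rfl

/-- The `M` coefficients are below `KB3`. -/
lemma cPosMB_lt (D P : Fin 10 → Bool) (k : Fin 10 → Fin 4) : cPosMB b D P k < KB3 := by
  unfold cPosMB; rw [KB3_val]
  have := csumT1e1_le (cPosOnB b) (2 * 59049) (cPosOnB_le b) D P k
  have := csumT1_le (cNegOnB b) (2 * 59049) (cNegOnB_le b) D k
  omega

/-- The `M` coefficients are below `KB3`. -/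
lemma cNegMB_lt (D P : Fin 10 → Bool) (k : Fin 10 → Fin 4) : cNegMB b D P k < KB3 := by
  unfold cNegMB; rw [KB3_val]
  have := csumT1e1_le (cNegOnB b) (2 * 59049) (cNegOnB_le b) D P k
  have := csumT1_le (cPosOnB b) (2 * 59049) (cPosOnB_le b) D k
  omega

/-- The `TvT` coefficients are below `KB3`. -/
lemma cPosTvTB_lt (x y z : ℕ) (k : Fin 10 → Fin 4) : cPosTvTB b x y z k < KB3 := by
  unfold cPosTvTB; rw [KB3_val]
  have := csumE3_le (cPosOnB b) (2 * 59049) (cPosOnB_le b) (pairMask x y) (pairMask x z) (pairMask y z) k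
  have := csumT1_le (cNegOnB b) (2 * 59049) (cNegOnB_le b) (triMask x y z) k
  omega

/-- The `TvT` coefficients are below `KB3`. -/
lemma cNegTvTB_lt (x y z : ℕ) (k : Fin 10 → Fin 4) : cNegTvTB b x y z k < KB3 := by
  unfold cNegTvTB; rw [KB3_val]
  have := csumE3_le (cNegOnB b) (2 * 59049) (cNegOnB_le b) (pairMask x y) (pairMask x z) (pairMask y z) k
  have := csumT1_le (cPosOnB b) (2 * 59049) (cPosOnB_le b) (triMask x y z) k
  omega

/-- **`M(H, T, e) ≥ 0` at the marking `b`, at every `K₅` profile**, from its certificate. -/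
theorem cNegMB_le_cPosMB (D P : Fin 10 → Bool) (hc : CertLE (kNegMB b D P) (kPosMB b D P))
    (k : Fin 10 → Fin 4) : cNegMB b D P k ≤ cPosMB b D P k :=
  le_of_certLE (cPosMB b D P) (cNegMB b D P) (cPosMB_lt b D P) (cNegMB_lt b D P) (kPosMB_eq b D P)
    (kNegMB_eq b D P) hc k

/-- **`TvT-(ii) ≥ 0` at the marking `b`, at every `K₅` profile**, from its certificate. -/
theorem cNegTvTB_le_cPosTvTB (x y z : ℕ) (hc : CertLE (kNegTvTB b x y z) (kPosTvTB b x y z))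
    (k : Fin 10 → Fin 4) : cNegTvTB b x y z k ≤ cPosTvTB b x y z k :=
  le_of_certLE (cPosTvTB b x y z) (cNegTvTB b x y z) (cPosTvTB_lt b x y z) (cNegTvTB_lt b x y z)
    (kPosTvTB_eq b x y z) (kNegTvTB_eq b x y z) hc k

/-- **`N(H + D(1)) ≥ 0` at the marking `b`, at every `K₅` profile**, from its certificate. -/
theorem cT1B_le (D : Fin 10 → Bool) (hc : CertLE (sumT1 (negOnB b) D) (sumT1 (posOnB b) D))
    (k : Fin 10 → Fin 4) : csumT1 (cNegOnB b) D k ≤ csumT1 (cPosOnB b) D k :=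
  le_of_certLE (csumT1 (cPosOnB b) D) (csumT1 (cNegOnB b) D)
    (fun k => by rw [KB3_val]; have := csumT1_le (cPosOnB b) (2 * 59049) (cPosOnB_le b) D k; omega)
    (fun k => by rw [KB3_val]; have := csumT1_le (cNegOnB b) (2 * 59049) (cNegOnB_le b) D k; omega)
    (sumT1_eq (cPosOnB b) (posOnB b) (posOnB_eq b) D) (sumT1_eq (cNegOnB b) (negOnB b) (negOnB_eq b) D) hc k

/-- **`N(H + D(2)) ≥ 0` at the marking `b`, at every `K₅` profile**, from its certificate. -/
theorem cT2B_le (D : Fin 10 → Bool) (hc : CertLE (sumT2 (negOnB b) D) (sumT2 (posOnB b) D))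
    (k : Fin 10 → Fin 4) : csumT2 (cNegOnB b) D k ≤ csumT2 (cPosOnB b) D k :=
  le_of_certLE (csumT2 (cPosOnB b) D) (csumT2 (cNegOnB b) D)
    (fun k => by rw [KB3_val]; have := csumT2_le (cPosOnB b) (2 * 59049) (cPosOnB_le b) D k; omega)
    (fun k => by rw [KB3_val]; have := csumT2_le (cNegOnB b) (2 * 59049) (cNegOnB_le b) D k; omega)
    (sumT2_eq (cPosOnB b) (posOnB b) (posOnB_eq b) D) (sumT2_eq (cNegOnB b) (negOnB b) (negOnB_eq b) D) hc k

/-! ## The comparisons, (i) side (count `cNeg − cPos`) -/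

/-- The positive side of `M-(i)` at the marking `b`: `N⁽ⁱ⁾(H+T(1)+e(1))⁻ + N⁽ⁱ⁾(H+T(1))⁺`. -/
def cPosMIB (D P : Fin 10 → Bool) (k : Fin 10 → Fin 4) : ℕ :=
  csumT1e1 (cNegOnIB b) D P k + csumT1 (cPosOnIB b) D k

/-- The negative side of `M-(i)` at the marking `b`. -/
def cNegMIB (D P : Fin 10 → Bool) (k : Fin 10 → Fin 4) : ℕ :=
  csumT1e1 (cPosOnIB b) D P k + csumT1 (cNegOnIB b) D k

/-- The positive side of `TvT-(i)` at the marking `b`: `N⁽ⁱ⁾(H+△(1,1,1))⁻ + N⁽ⁱ⁾(H+T(1))⁺`. -/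
def cPosTvTIB (x y z : ℕ) (k : Fin 10 → Fin 4) : ℕ :=
  csumE3 (cNegOnIB b) (pairMask x y) (pairMask x z) (pairMask y z) k + csumT1 (cPosOnIB b) (triMask x y z) k

/-- The negative side of `TvT-(i)` at the marking `b`. -/
def cNegTvTIB (x y z : ℕ) (k : Fin 10 → Fin 4) : ℕ :=
  csumE3 (cPosOnIB b) (pairMask x y) (pairMask x z) (pairMask y z) k + csumT1 (cNegOnIB b) (triMask x y z) k

/-- `kPosMIB b` encodes `cPosMIB b`. -/
lemma kPosMIB_eq (D P : Fin 10 → Bool) : kPosMIB b D P = ∑ k, cPosMIB b D P k * KB3 ^ idx4 k := by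
  unfold kPosMIB
  rw [sumT1e1_eq (cNegOnIB b) (negOnIB b) (negOnIB_eq b), sumT1_eq (cPosOnIB b) (posOnIB b) (posOnIB_eq b),
    sum_add_mulB]
  rfl

/-- `kNegMIB b` encodes `cNegMIB b`. -/
lemma kNegMIB_eq (D P : Fin 10 → Bool) : kNegMIB b D P = ∑ k, cNegMIB b D P k * KB3 ^ idx4 k := by
  unfold kNegMIB
  rw [sumT1e1_eq (cPosOnIB b) (posOnIB b) (posOnIB_eq b), sumT1_eq (cNegOnIB b) (negOnIB b) (negOnIB_eq b),
    sum_add_mulB]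
  rfl

/-- `kPosTvTIB b` encodes `cPosTvTIB b`. -/
lemma kPosTvTIB_eq (x y z : ℕ) : kPosTvTIB b x y z = ∑ k, cPosTvTIB b x y z k * KB3 ^ idx4 k := by
  unfold kPosTvTIB
  rw [sumE3_eq (cNegOnIB b) (negOnIB b) (negOnIB_eq b), sumT1_eq (cPosOnIB b) (posOnIB b) (posOnIB_eq b),
    sum_add_mulB]
  rfl

/-- `kNegTvTIB b` encodes `cNegTvTIB b`. -/
lemma kNegTvTIB_eq (x y z : ℕ) : kNegTvTIB b x y z = ∑ k, cNegTvTIB b x y z k * KB3 ^ idx4 k := by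
  unfold kNegTvTIB
  rw [sumE3_eq (cPosOnIB b) (posOnIB b) (posOnIB_eq b), sumT1_eq (cNegOnIB b) (negOnIB b) (negOnIB_eq b),
    sum_add_mulB]
  rfl

/-- The `M-(i)` coefficients are below `KB3`. -/
lemma cPosMIB_lt (D P : Fin 10 → Bool) (k : Fin 10 → Fin 4) : cPosMIB b D P k < KB3 := by
  unfold cPosMIB; rw [KB3_val]
  have := csumT1e1_le (cNegOnIB b) (2 * 59049) (cNegOnIB_le b) D P k
  have := csumT1_le (cPosOnIB b) (2 * 59049) (cPosOnIB_le b) D k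
  omega

/-- The `M-(i)` coefficients are below `KB3`. -/
lemma cNegMIB_lt (D P : Fin 10 → Bool) (k : Fin 10 → Fin 4) : cNegMIB b D P k < KB3 := by
  unfold cNegMIB; rw [KB3_val]
  have := csumT1e1_le (cPosOnIB b) (2 * 59049) (cPosOnIB_le b) D P k
  have := csumT1_le (cNegOnIB b) (2 * 59049) (cNegOnIB_le b) D k
  omega

/-- The `TvT-(i)` coefficients are below `KB3`. -/
lemma cPosTvTIB_lt (x y z : ℕ) (k : Fin 10 → Fin 4) : cPosTvTIB b x y z k < KB3 := by
  unfold cPosTvTIB; rw [KB3_val]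
  have := csumE3_le (cNegOnIB b) (2 * 59049) (cNegOnIB_le b) (pairMask x y) (pairMask x z) (pairMask y z) k
  have := csumT1_le (cPosOnIB b) (2 * 59049) (cPosOnIB_le b) (triMask x y z) k
  omega

/-- The `TvT-(i)` coefficients are below `KB3`. -/
lemma cNegTvTIB_lt (x y z : ℕ) (k : Fin 10 → Fin 4) : cNegTvTIB b x y z k < KB3 := by
  unfold cNegTvTIB; rw [KB3_val]
  have := csumE3_le (cPosOnIB b) (2 * 59049) (cPosOnIB_le b) (pairMask x y) (pairMask x z) (pairMask y z) k
  have := csumT1_le (cNegOnIB b) (2 * 59049) (cNegOnIB_le b) (triMask x y z) k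
  omega

/-- **`M-(i) ≥ 0` at the marking `b`, at every `K₅` profile**, from its certificate. -/
theorem cNegMIB_le_cPosMIB (D P : Fin 10 → Bool) (hc : CertLE (kNegMIB b D P) (kPosMIB b D P))
    (k : Fin 10 → Fin 4) : cNegMIB b D P k ≤ cPosMIB b D P k :=
  le_of_certLE (cPosMIB b D P) (cNegMIB b D P) (cPosMIB_lt b D P) (cNegMIB_lt b D P) (kPosMIB_eq b D P)
    (kNegMIB_eq b D P) hc k

/-- **`TvT-(i) ≥ 0` at the marking `b`, at every `K₅` profile**, from its certificate. -/
theorem cNegTvTIB_le_cPosTvTIB (x y z : ℕ) (hc : CertLE (kNegTvTIB b x y z) (kPosTvTIB b x y z))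
    (k : Fin 10 → Fin 4) : cNegTvTIB b x y z k ≤ cPosTvTIB b x y z k :=
  le_of_certLE (cPosTvTIB b x y z) (cNegTvTIB b x y z) (cPosTvTIB_lt b x y z) (cNegTvTIB_lt b x y z)
    (kPosTvTIB_eq b x y z) (kNegTvTIB_eq b x y z) hc k

/-- **`N⁽ⁱ⁾(H + D(1)) ≥ 0` at the marking `b`, at every `K₅` profile**, from its certificate. -/
theorem cT1IB_le (D : Fin 10 → Bool) (hc : CertLE (sumT1 (posOnIB b) D) (sumT1 (negOnIB b) D))
    (k : Fin 10 → Fin 4) : csumT1 (cPosOnIB b) D k ≤ csumT1 (cNegOnIB b) D k :=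
  le_of_certLE (csumT1 (cNegOnIB b) D) (csumT1 (cPosOnIB b) D)
    (fun k => by rw [KB3_val]; have := csumT1_le (cNegOnIB b) (2 * 59049) (cNegOnIB_le b) D k; omega)
    (fun k => by rw [KB3_val]; have := csumT1_le (cPosOnIB b) (2 * 59049) (cPosOnIB_le b) D k; omega)
    (sumT1_eq (cNegOnIB b) (negOnIB b) (negOnIB_eq b) D) (sumT1_eq (cPosOnIB b) (posOnIB b) (posOnIB_eq b) D) hc k

/-- **`N⁽ⁱ⁾(H + D(2)) ≥ 0` at the marking `b`, at every `K₅` profile**, from its certificate. -/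
theorem cT2IB_le (D : Fin 10 → Bool) (hc : CertLE (sumT2 (posOnIB b) D) (sumT2 (negOnIB b) D))
    (k : Fin 10 → Fin 4) : csumT2 (cPosOnIB b) D k ≤ csumT2 (cNegOnIB b) D k :=
  le_of_certLE (csumT2 (cNegOnIB b) D) (csumT2 (cPosOnIB b) D)
    (fun k => by rw [KB3_val]; have := csumT2_le (cNegOnIB b) (2 * 59049) (cNegOnIB_le b) D k; omega)
    (fun k => by rw [KB3_val]; have := csumT2_le (cPosOnIB b) (2 * 59049) (cPosOnIB_le b) D k; omega)
    (sumT2_eq (cNegOnIB b) (negOnIB b) (negOnIB_eq b) D) (sumT2_eq (cPosOnIB b) (posOnIB b) (posOnIB_eq b) D) hc k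

end CoeffsB

end K5

end Summit.Ventures.PercRepro2
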